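import Summits.MatrixMultiplication.MatrixMultiplication.Theorems.ObstructionDescentHullDesign
import Literature.Computability.AlgebraicComplexity.AsymptoticRankZariskiClosedProofs

/- `set_option linter.dupNamespace false` as in the sibling kernel files (namespace `…Theorems.<FileStem>`). -/
set_option linter.dupNamespace false

/-!
# The poly-degree hull is decided by the top Kronecker power alone (decomp-mm · lens 3 · gen 25, part 2)

Route `route-MatrixMultiplication-ObstructionDescent` (`ω(ℂ) = 2`), leaf `E = NoPolyDegreeObstruction` (item 30889).  Part 1
(`ObstructionDescentHullDesign`) proved the design duality `t ∈ Hull_D(σ_m) ⟺ ∃` finitely many `u_j` of rank `≤ m` and weights `w_j`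
with `t^{⊠d} = ∑ⱼ w_j u_j^{⊠d}` for EVERY `d ≤ D`.  This module removes the lower levels: the design span is GRADED (it is stable
under the scalings `u ↦ c • u`, and `(c • u)^{⊠d} = c^d · u^{⊠d}`, so a Vandermonde / polynomial-identity argument puts every level
of a generator in the span, `single_level_mem_span`), and a top-level design DESCENDS to all lower levels by contracting one
prepended cell `p` with `t_p ≠ 0` (`t_p · t^{⊠d} = (t^{⊠(d+1)})(p∷·)`, `exists_design_of_succ`).  Hence

* `mem_hull_iff_exists_top_design : t ∈ Hull_D(σ_m) ⟺ ∃ S ⊂ σ_m finite, w,  t^{⊠D} = ∑_{u ∈ S} w_u · u^{⊠D}`,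
  i.e. (`mem_hull_iff_kroneckerPow_mem_span`) `t^{⊠D} ∈ span {u^{⊠D} | rank u ≤ m}` — the VERONESE READING: the equations of
  `σ_m` of degree `≤ D` are exactly the linear forms on the `D`-th tensor power vanishing on `{u^{⊠D} | u ∈ σ_m}`
  (`x^{⊠D}` is the `D`-th Veronese/tensor power `x^{⊗D}` re-indexed as a `3`-tensor);
* THE LEAF (`noPolyDegreeObstruction_iff_exists_top_design`, `…_iff_kroneckerPow_mem_span`):

      `E ⟺ ∀ c, ∀ τ > 2, eventually on the cells n² ≤ m, n^τ ≤ m:   ⟨n,n,n⟩^{⊠ m^c} ∈ span_ℂ { u^{⊠ m^c} | u ∈ (ℂ^{n×n})^{⊗3}, rank u ≤ m }`,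

  one linear-span condition per cell on the single tensor `⟨n,n,n⟩^{⊠N} ≅ ⟨n^N, n^N, n^N⟩`, `N = m^c` (whose own rank is
  `≥ n^{2N}`, while each `u^{⊠N}` has rank `≤ m^N`): matrix multiplication of size `n^N` must be a LINEAR COMBINATION (not a limit,
  not a sum with few terms) of `N`-th Kronecker powers of corner tensors of rank `≤ m ≈ n^{2+ε}`.

Elementary linear algebra over part 1; nothing here concerns `ω`; sorry-free; standard axioms only.
[cite: LandsbergGCT2017, §3.1.2 (p. 57), §8.3.2 (p. 226); BurgisserClausenShokrollahi1997, Prop. (15.25) (pdf p. 423)]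
-/

set_option autoImplicit false

noncomputable section

open scoped BigOperators

namespace Summit.MatrixMultiplication.MatrixMultiplication.Theorems.ObstructionDescentHullDesignTop

open Literature.Computability.AlgebraicComplexity (tensorRank kroneckerPow kroneckerPow_apply matMulTensor tensorRank_smul_le
  tensorRank_zero)
open Summit.MatrixMultiplication.MatrixMultiplication.Theorems.ObstructionDescentHullCalculus (hull mem_hull_of_tensorRank_le)
open Summit.MatrixMultiplication.MatrixMultiplication.Theorems.ObstructionDescentHullDescent (noPolyDegreeObstruction_iff_hull)
open Summit.MatrixMultiplication.MatrixMultiplication.Theses.ObstructionDescent (NoPolyDegreeObstruction)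
open Summit.MatrixMultiplication.MatrixMultiplication.Theorems.ObstructionDescentHullDesign (kroneckerPow_succ_vecCons
  mem_hull_iff_powerVector_mem_span mem_hull_iff_exists_design)

variable {α β γ : Type}

/-! ## §1 The design span is graded -/

section Graded

/-- Kronecker powers of a scaled tensor: `(c • u)^{⊠d} = c^d · u^{⊠d}`. [folklore] -/
theorem kroneckerPow_smul (c : ℂ) (u : α → β → γ → ℂ) (d : ℕ) (a : Fin d → α) (b : Fin d → β) (c' : Fin d → γ) :
    kroneckerPow (c • u) d a b c' = c ^ d * kroneckerPow u d a b c' := by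
  simp only [kroneckerPow_apply, Pi.smul_apply, smul_eq_mul, Finset.prod_mul_distrib, Finset.prod_const, Finset.card_univ,
    Fintype.card_fin]

variable [Fintype α] [Fintype β] [Fintype γ]

/-- **Gradedness of the design span.**  For `u` of rank `≤ m` and any level `k`, the vector carrying `u^{⊠k}` at level `k` and `0`
at the other levels lies in the design span `span {pv_D u' | rank u' ≤ m}` (a functional `φ` killing the span kills
`pv_D (c • u) = ∑_k c^k · (level-k piece)` for every `c ∈ ℂ`, a polynomial identity in `c`, so it kills each piece; conclude by
`W = W^⊥⊥`). [folklore] -/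
theorem single_level_mem_span {m D : ℕ} {u : α → β → γ → ℂ} (hu : tensorRank u ≤ m) (k : ℕ) :
    (fun i : (Σ d : Fin (D + 1), (Fin d → α) × (Fin d → β) × (Fin d → γ)) =>
        if (i.1 : ℕ) = k then kroneckerPow u i.1 i.2.1 i.2.2.1 i.2.2.2 else 0) ∈
      Submodule.span ℂ ((fun u' : α → β → γ → ℂ =>
        fun i : (Σ d : Fin (D + 1), (Fin d → α) × (Fin d → β) × (Fin d → γ)) => kroneckerPow u' i.1 i.2.1 i.2.2.1 i.2.2.2) ''
          {u' : α → β → γ → ℂ | tensorRank u' ≤ m}) := by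
  classical
  -- the level-`k'` pieces of the power vector of `u`
  set e : ℕ → (Σ d : Fin (D + 1), (Fin d → α) × (Fin d → β) × (Fin d → γ)) → ℂ :=
    fun k' i => if (i.1 : ℕ) = k' then kroneckerPow u i.1 i.2.1 i.2.2.1 i.2.2.2 else 0 with he
  show e k ∈ _
  rw [← Subspace.forall_mem_dualAnnihilator_apply_eq_zero_iff]
  intro φ hφ
  have hscale : ∀ c : ℂ,
      (fun i : (Σ d : Fin (D + 1), (Fin d → α) × (Fin d → β) × (Fin d → γ)) =>
        kroneckerPow (c • u) i.1 i.2.1 i.2.2.1 i.2.2.2) = ∑ k' ∈ Finset.range (D + 1), c ^ k' • e k' := by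
    intro c
    funext i
    rw [Finset.sum_apply]
    simp only [Pi.smul_apply, smul_eq_mul, he, mul_ite, mul_zero]
    rw [Finset.sum_ite_eq, if_pos (Finset.mem_range.2 i.1.2), kroneckerPow_smul]
  have hvan : ∀ c : ℂ, ∑ k' ∈ Finset.range (D + 1), φ (e k') * c ^ k' = 0 := by
    intro c
    have h0 : φ (fun i : (Σ d : Fin (D + 1), (Fin d → α) × (Fin d → β) × (Fin d → γ)) =>
        kroneckerPow (c • u) i.1 i.2.1 i.2.2.1 i.2.2.2) = 0 :=
      (Submodule.mem_dualAnnihilator φ).1 hφ _ (Submodule.subset_span ⟨c • u, (tensorRank_smul_le c u).trans hu, rfl⟩)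
    rw [hscale c, map_sum] at h0
    simpa only [map_smul, smul_eq_mul, mul_comm] using h0
  have hP : (∑ k' ∈ Finset.range (D + 1), Polynomial.C (φ (e k')) * Polynomial.X ^ k' : Polynomial ℂ) = 0 := by
    apply Polynomial.funext
    intro c
    rw [Polynomial.eval_finsetSum, Polynomial.eval_zero]
    simpa only [Polynomial.eval_mul, Polynomial.eval_C, Polynomial.eval_pow, Polynomial.eval_X] using hvan c
  have hk := congr_arg (fun P : Polynomial ℂ => P.coeff k) hP
  simp only [Polynomial.finsetSum_coeff, Polynomial.coeff_C_mul_X_pow, Polynomial.coeff_zero] at hk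
  rw [Finset.sum_ite_eq] at hk
  by_cases hkD : k ∈ Finset.range (D + 1)
  · rwa [if_pos hkD] at hk
  · have h0 : e k = 0 := by
      funext i
      exact if_neg fun h : (i.1 : ℕ) = k => hkD (Finset.mem_range.2 (h ▸ i.1.2))
    rw [h0, map_zero]

end Graded

/-! ## §2 A top-level design descends to the lower levels -/

section Descent

/-- **Descent by contracting a cell.**  If `t_p ≠ 0` and `t^{⊠(d+1)} = ∑_u w_u · u^{⊠(d+1)}`, then evaluating at the index triples
prepended by `p` gives `t^{⊠d} = ∑_u (w_u u_p / t_p) · u^{⊠d}` — a design one level down with the SAME tensors. [folklore] -/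
theorem exists_design_of_succ {m d : ℕ} {t : α → β → γ → ℂ} (p : α × β × γ) (hp : t p.1 p.2.1 p.2.2 ≠ 0)
    (h : ∃ S : Finset (α → β → γ → ℂ), (∀ u ∈ S, tensorRank u ≤ m) ∧
      ∃ w : ↥S → ℂ, kroneckerPow t (d + 1) = ∑ u : ↥S, w u • kroneckerPow (u : α → β → γ → ℂ) (d + 1)) :
    ∃ S : Finset (α → β → γ → ℂ), (∀ u ∈ S, tensorRank u ≤ m) ∧
      ∃ w : ↥S → ℂ, kroneckerPow t d = ∑ u : ↥S, w u • kroneckerPow (u : α → β → γ → ℂ) d := by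
  obtain ⟨S, hS, w, hw⟩ := h
  refine ⟨S, hS, fun u => (t p.1 p.2.1 p.2.2)⁻¹ * (w u * (u : α → β → γ → ℂ) p.1 p.2.1 p.2.2), ?_⟩
  funext a b c
  have h1 := congr_fun (congr_fun (congr_fun hw (Matrix.vecCons p.1 a)) (Matrix.vecCons p.2.1 b)) (Matrix.vecCons p.2.2 c)
  rw [kroneckerPow_succ_vecCons, Finset.sum_apply, Finset.sum_apply, Finset.sum_apply] at h1
  simp only [Pi.smul_apply, smul_eq_mul, kroneckerPow_succ_vecCons] at h1
  rw [Finset.sum_apply, Finset.sum_apply, Finset.sum_apply]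
  simp only [Pi.smul_apply, smul_eq_mul]
  calc kroneckerPow t d a b c = (t p.1 p.2.1 p.2.2)⁻¹ * (t p.1 p.2.1 p.2.2 * kroneckerPow t d a b c) := by
        rw [← mul_assoc, inv_mul_cancel₀ hp, one_mul]
    _ = (t p.1 p.2.1 p.2.2)⁻¹ *
          ∑ u : ↥S, w u * ((u : α → β → γ → ℂ) p.1 p.2.1 p.2.2 * kroneckerPow (u : α → β → γ → ℂ) d a b c) := by rw [h1]
    _ = ∑ u : ↥S, (t p.1 p.2.1 p.2.2)⁻¹ * (w u * (u : α → β → γ → ℂ) p.1 p.2.1 p.2.2) *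
          kroneckerPow (u : α → β → γ → ℂ) d a b c := by
        rw [Finset.mul_sum]
        exact Finset.sum_congr rfl fun u _ => by ring

/-- Iterated descent: a design at level `d + j` gives one at level `d` (for `t` with a nonzero entry). [bookkeeping] -/
theorem exists_design_of_add {m : ℕ} {t : α → β → γ → ℂ} (p : α × β × γ) (hp : t p.1 p.2.1 p.2.2 ≠ 0) (j : ℕ) :
    ∀ d : ℕ, (∃ S : Finset (α → β → γ → ℂ), (∀ u ∈ S, tensorRank u ≤ m) ∧
      ∃ w : ↥S → ℂ, kroneckerPow t (d + j) = ∑ u : ↥S, w u • kroneckerPow (u : α → β → γ → ℂ) (d + j)) →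
    ∃ S : Finset (α → β → γ → ℂ), (∀ u ∈ S, tensorRank u ≤ m) ∧
      ∃ w : ↥S → ℂ, kroneckerPow t d = ∑ u : ↥S, w u • kroneckerPow (u : α → β → γ → ℂ) d := by
  induction j with
  | zero => intro d h; simpa only [Nat.add_zero] using h
  | succ j ih =>
    intro d h
    refine exists_design_of_succ p hp (ih (d + 1) ?_)
    rw [Nat.add_right_comm]
    exact h

end Descent

/-! ## §3 Hull membership = a design at the top level only -/

section Top

variable [Fintype α] [Fintype β] [Fintype γ]

/-- **Top-level design criterion.**  `t ∈ Hull_D(σ_m)` iff finitely many tensors `u ∈ S` of rank `≤ m` and weights `w` satisfy the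
single identity `t^{⊠D} = ∑_{u ∈ S} w_u · u^{⊠D}`.  (`⟹` part 1; `⟸`: descend the design to every level `d ≤ D` (`§2`, using a
nonzero entry of `t`; `t = 0` is in every hull), then reassemble the power vector level by level inside the graded design span
(`§1`) and apply part 1.) [cite: LandsbergGCT2017, §3.1.2 (p. 57), §8.3.2 (p. 226)] -/
theorem mem_hull_iff_exists_top_design {m D : ℕ} (t : α → β → γ → ℂ) :
    t ∈ hull α β γ m D ↔ ∃ S : Finset (α → β → γ → ℂ), (∀ u ∈ S, tensorRank u ≤ m) ∧
      ∃ w : ↥S → ℂ, kroneckerPow t D = ∑ u : ↥S, w u • kroneckerPow (u : α → β → γ → ℂ) D := by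
  classical
  constructor
  · intro ht
    obtain ⟨S, hS, w, hw⟩ := (mem_hull_iff_exists_design t).1 ht
    exact ⟨S, hS, w, hw D le_rfl⟩
  · intro hD
    by_cases ht0 : t = 0
    · subst ht0
      exact mem_hull_of_tensorRank_le (by rw [tensorRank_zero]; exact Nat.zero_le _)
    obtain ⟨p, hp⟩ : ∃ p : α × β × γ, t p.1 p.2.1 p.2.2 ≠ 0 := by
      by_contra hcon
      exact ht0 (funext fun a => funext fun b => funext fun c => not_not.1 (not_exists.1 hcon (a, b, c)))
    have hall : ∀ d : ℕ, d ≤ D → ∃ S : Finset (α → β → γ → ℂ), (∀ u ∈ S, tensorRank u ≤ m) ∧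
        ∃ w : ↥S → ℂ, kroneckerPow t d = ∑ u : ↥S, w u • kroneckerPow (u : α → β → γ → ℂ) d := by
      intro d hd
      obtain ⟨j, rfl⟩ := Nat.exists_eq_add_of_le hd
      exact exists_design_of_add p hp j d hD
    rw [mem_hull_iff_powerVector_mem_span]
    have hdecomp : (fun i : (Σ d : Fin (D + 1), (Fin d → α) × (Fin d → β) × (Fin d → γ)) =>
        kroneckerPow t i.1 i.2.1 i.2.2.1 i.2.2.2) = ∑ k ∈ Finset.range (D + 1),
          fun i : (Σ d : Fin (D + 1), (Fin d → α) × (Fin d → β) × (Fin d → γ)) =>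
            if (i.1 : ℕ) = k then kroneckerPow t i.1 i.2.1 i.2.2.1 i.2.2.2 else 0 := by
      funext i
      rw [Finset.sum_apply, Finset.sum_ite_eq, if_pos (Finset.mem_range.2 i.1.2)]
    rw [hdecomp]
    refine Submodule.sum_mem _ fun k hk => ?_
    obtain ⟨S, hS, w, hw⟩ := hall k (Nat.lt_succ_iff.1 (Finset.mem_range.1 hk))
    have hEk : (fun i : (Σ d : Fin (D + 1), (Fin d → α) × (Fin d → β) × (Fin d → γ)) =>
          if (i.1 : ℕ) = k then kroneckerPow t i.1 i.2.1 i.2.2.1 i.2.2.2 else 0) =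
        ∑ u : ↥S, w u • fun i : (Σ d : Fin (D + 1), (Fin d → α) × (Fin d → β) × (Fin d → γ)) =>
          if (i.1 : ℕ) = k then kroneckerPow (u : α → β → γ → ℂ) i.1 i.2.1 i.2.2.1 i.2.2.2 else 0 := by
      funext i
      rw [Finset.sum_apply]
      simp only [Pi.smul_apply, smul_eq_mul, mul_ite, mul_zero]
      by_cases hi : (i.1 : ℕ) = k
      · simp only [if_pos hi]
        subst hi
        have h1 := congr_fun (congr_fun (congr_fun hw i.2.1) i.2.2.1) i.2.2.2
        rw [Finset.sum_apply, Finset.sum_apply, Finset.sum_apply] at h1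
        simpa only [Pi.smul_apply, smul_eq_mul] using h1
      · simp only [if_neg hi, Finset.sum_const_zero]
    rw [hEk]
    exact Submodule.sum_mem _ fun u _ => Submodule.smul_mem _ _ (single_level_mem_span (hS u u.2) k)

/-- The same criterion in span form: `t ∈ Hull_D(σ_m) ⟺ t^{⊠D} ∈ span_ℂ {u^{⊠D} | rank u ≤ m}` (the Veronese reading: degree-`≤ D`
equations of `σ_m` = linear forms on `D`-th powers vanishing on the powers of `σ_m`). [cite: LandsbergGCT2017, §3.1.2 (p. 57)] -/
theorem mem_hull_iff_kroneckerPow_mem_span {m D : ℕ} (t : α → β → γ → ℂ) :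
    t ∈ hull α β γ m D ↔ kroneckerPow t D ∈
      Submodule.span ℂ ((fun u : α → β → γ → ℂ => kroneckerPow u D) '' {u : α → β → γ → ℂ | tensorRank u ≤ m}) := by
  rw [mem_hull_iff_exists_top_design, Submodule.mem_span_image_iff_exists_fun]
  constructor
  · rintro ⟨S, hS, w, hw⟩
    exact ⟨S, fun u hu => hS u hu, w, hw.symm⟩
  · rintro ⟨S, hS, w, hw⟩
    exact ⟨S, fun u hu => hS hu, w, hw.symm⟩

end Top

/-! ## §4 The leaf `E`: one linear-span condition on `⟨n,n,n⟩^{⊠ m^c}` per cell -/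

section Leaf

/-- **`E` by top-level designs**: `E ⟺ ∀ c, ∀ τ > 2`, eventually on the cells `n² ≤ m`, `n^τ ≤ m`, the single tensor
`⟨n,n,n⟩^{⊠ m^c}` (`≅ ⟨n^{m^c}, n^{m^c}, n^{m^c}⟩`) is a linear combination `∑_u w_u · u^{⊠ m^c}` of `m^c`-th Kronecker powers of
finitely many corner tensors `u ∈ (ℂ^{n×n})^{⊗3}` of rank `≤ m`. [route E = NoPolyDegreeObstruction, top-design form] -/
theorem noPolyDegreeObstruction_iff_exists_top_design : NoPolyDegreeObstruction ↔
    ∀ c : ℕ, ∀ τ : ℝ, 2 < τ → ∃ n₀ : ℕ, ∀ n m : ℕ, n₀ ≤ n → n * n ≤ m → (n : ℝ) ^ τ ≤ (m : ℝ) →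
      ∃ S : Finset (Fin n × Fin n → Fin n × Fin n → Fin n × Fin n → ℂ), (∀ u ∈ S, tensorRank u ≤ m) ∧
        ∃ w : ↥S → ℂ, kroneckerPow (fun a b c => matMulTensor ℂ n n n a b c) (m ^ c) =
          ∑ u : ↥S, w u • kroneckerPow (u : Fin n × Fin n → Fin n × Fin n → Fin n × Fin n → ℂ) (m ^ c) := by
  rw [noPolyDegreeObstruction_iff_hull]
  refine forall_congr' fun c => forall_congr' fun τ => forall_congr' fun _ => exists_congr fun n₀ =>
    forall_congr' fun n => forall_congr' fun m => forall_congr' fun _ => forall_congr' fun _ =>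
      forall_congr' fun _ => ?_
  exact mem_hull_iff_exists_top_design _

/-- **`E` in Veronese form**: `E ⟺` at the cells, `⟨n,n,n⟩^{⊠ m^c} ∈ span_ℂ {u^{⊠ m^c} | u ∈ (ℂ^{n×n})^{⊗3}, rank u ≤ m}`.
[route E = NoPolyDegreeObstruction, top-design form] -/
theorem noPolyDegreeObstruction_iff_kroneckerPow_mem_span : NoPolyDegreeObstruction ↔
    ∀ c : ℕ, ∀ τ : ℝ, 2 < τ → ∃ n₀ : ℕ, ∀ n m : ℕ, n₀ ≤ n → n * n ≤ m → (n : ℝ) ^ τ ≤ (m : ℝ) →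
      kroneckerPow (fun a b c => matMulTensor ℂ n n n a b c) (m ^ c) ∈
        Submodule.span ℂ ((fun u : Fin n × Fin n → Fin n × Fin n → Fin n × Fin n → ℂ => kroneckerPow u (m ^ c)) ''
          {u : Fin n × Fin n → Fin n × Fin n → Fin n × Fin n → ℂ | tensorRank u ≤ m}) := by
  rw [noPolyDegreeObstruction_iff_hull]
  refine forall_congr' fun c => forall_congr' fun τ => forall_congr' fun _ => exists_congr fun n₀ =>
    forall_congr' fun n => forall_congr' fun m => forall_congr' fun _ => forall_congr' fun _ =>
      forall_congr' fun _ => ?_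
  exact mem_hull_iff_kroneckerPow_mem_span _

end Leaf

end Summit.MatrixMultiplication.MatrixMultiplication.Theorems.ObstructionDescentHullDesignTop

end
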